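import Literature.NumberTheory.Automorphic.CongruenceSubgroupPropertySL2Dirichlet
import Literature.NumberTheory.LFunctions.NormDirichletCharacter
import Mathlib.NumberTheory.Cyclotomic.Basic
import HarnessLib

/-!
# Serre's congruence subgroup property for `SL₂(𝓞_F)` — proofs, III: Serre's Lemme 3
# (no element of order divisible by `l^{e+1}` modulo a suitable `a ≡ a₀`)

Topic `Literature/NumberTheory/Automorphic`; namespace `Literature.NumberTheory.Automorphic`
(sub-namespace `SerreSL2`).  Everything here is PROVED; no named facts.

**Serre 1970, §2.2 Lemme 3.** *Soit `l` un nombre premier, et soit `lᵉ` la plus grande puissance de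
`l` divisant `m = Card(μ)`. Soit `a₀ ∈ A` et soit `𝔯` un idéal non nul de `A` tel que `a₀` soit
inversible modulo `𝔯`. Il existe alors `a ∈ A`, avec `a ≡ a₀ (mod 𝔯)`, tel que `U(a)` ne contienne pas
d'élément d'ordre multiple de `l^{e+1}`.*  (Here `U(a) = (A/aA)ˣ`.)  Serre deduces it (§2.3) from
Lemme 4, proved with the existence theorem of class field theory and Čebotarev's theorem in
`L · K_𝔯`; Bass–Milnor–Serre prove the same statement as Thm. 3.2 of Ch. I from Dirichlet's theorem
(A.11) and the cyclotomic case of Čebotarev (A.8).  It is the arithmetic input both of Vaserstein's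
Lemma 5 (`T^s B T^{-s} ∈ E(I, I) B E(I, I)`, `s = m/2`, via "НОД чисел `Φ(a + xb)` делит `m`") and
of step (ii) of the proof of BMS Thm. 3.6 (every Mennicke symbol has order dividing `m`).

We prove it for a number field `K` **with a real embedding** (so `m = 2`, `e = v_l(2)`) and
`𝔯 = (b)` principal (the only case used), in the form

* `SerreSL2.exists_add_mul_forall_not_dvd_orderOf` : for `a, b ∈ 𝓞_K` coprime, `b ≠ 0`, and a prime
  `l`, there is `t` with `a + tb ≠ 0` such that no unit of `𝓞_K/(a + tb)` has order divisible by
  `l ^ (v_l(2) + 1)`.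

Proof (BMS Thm. 3.2 with the bookkeeping of the norm residue made explicit, so that only the
tree's ray-class Dirichlet theorem and cyclotomic Chebotarev theorem are needed): put
`L = l^{v_l(2)+1} ∈ {4, l}` and `N = K(ζ_L) ≠ K`; replace `a` by `x = a + t₀ b` prime to `l`
(Chinese remainder theorem) and work modulo `𝔪 = (bL)`; let `c = N((x)) mod L`.  If `c ≠ 1`,
Dirichlet gives a prime `(π)`, `π ≡ x (mod 𝔪)` of the signs of `x`, so `N((π)) ≡ c ≢ 1 (mod L)`
(`LFunctions.natCast_absNorm_span_singleton_eq`) and `(A/π)ˣ` is cyclic of order `N(π) - 1`, not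
divisible by `L`.  If `c = 1`, pick `τ ∈ Gal(N/K)` with `χ_L(τ) = h ≠ 1`
(`exists_cycloChar_ne_one`), a prime `𝔭₁ ∤ 𝔪` with `N𝔭₁ ≡ h` (`exists_prime_natCast_absNorm_eq`),
then a prime `𝔭₂ ≠ 𝔭₁` with `𝔭₁ 𝔭₂ = (π)`, `π ≡ x (mod 𝔪)` (`exists_prime_mul_eq_span_singleton`);
now `N𝔭₁ N𝔭₂ ≡ 1` forces `N𝔭₂ ≢ 1`, and `(A/π)ˣ ≅ (A/𝔭₁)ˣ × (A/𝔭₂)ˣ` has exponent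
`lcm(N𝔭₁ - 1, N𝔭₂ - 1)`, of `l`-adic valuation `≤ v_l(2)`.

## References

* [SerreSL2Congruence1970] J.-P. Serre, Ann. of Math. 92 (1970), §2.2 Lemme 3, §2.3 Lemme 4.
* [BassMilnorSerre1967] H. Bass, J. Milnor, J.-P. Serre, Publ. Math. IHES 33 (1967), Ch. I
  Thm. 3.2 and its proof; Appendix (A.8), (A.11).
* [Vaserstein1972SL2] L. N. Vaserstein, Mat. Sb. 89 (131) (1972), proof of Lemma 5.
-/

open NumberField IsDedekindDomain

namespace Literature.NumberTheory.Automorphic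

namespace SerreSL2

open Literature.NumberTheory.LFunctions Literature.NumberTheory.GaloisRepresentations

variable {K : Type*} [Field K] [NumberField K]

/-! ### Orders of units modulo one or two primes -/

/-- If `N𝔭 ≢ 1 (mod L)` then no unit of the residue field `𝓞_K/𝔭` has order divisible by `L`
(the unit group has order `N𝔭 - 1`). [folklore] -/
theorem not_dvd_orderOf_of_prime (v : HeightOneSpectrum (𝓞 K)) {L : ℕ}
    (hv : ((Ideal.absNorm v.asIdeal : ℕ) : ZMod L) ≠ 1) (u : (𝓞 K ⧸ v.asIdeal)ˣ) :
    ¬ L ∣ orderOf u := by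
  haveI := v.isMaximal
  haveI : Finite (𝓞 K ⧸ v.asIdeal) := Ideal.finiteQuotientOfFreeOfNeBot _ v.ne_bot
  letI : Field (𝓞 K ⧸ v.asIdeal) := Ideal.Quotient.field v.asIdeal
  intro hL
  have hcard : Nat.card (𝓞 K ⧸ v.asIdeal)ˣ = Ideal.absNorm v.asIdeal - 1 := by
    rw [Nat.card_units, ← Submodule.cardQuot_apply, ← Ideal.absNorm_apply]
  have hdvd : L ∣ Ideal.absNorm v.asIdeal - 1 := hcard ▸ hL.trans (orderOf_dvd_natCard u)
  have hpos : 1 ≤ Ideal.absNorm v.asIdeal := by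
    rw [Nat.one_le_iff_ne_zero, Ideal.absNorm_ne_zero_iff]
    infer_instance
  apply hv
  have := (ZMod.natCast_eq_natCast_iff' (Ideal.absNorm v.asIdeal) 1 L).mpr
    ((Nat.modEq_iff_dvd' hpos).mpr hdvd).symm
  rw [this, Nat.cast_one]

omit [NumberField K] in
/-- A prime power dividing `lcm(A, B)` divides `A` or `B`. [folklore] -/
theorem prime_pow_dvd_or_of_dvd_lcm {l k A B : ℕ} (hl : l.Prime) (hA : A ≠ 0) (hB : B ≠ 0)
    (h : l ^ k ∣ Nat.lcm A B) : l ^ k ∣ A ∨ l ^ k ∣ B := by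
  rw [hl.pow_dvd_iff_le_factorization (Nat.lcm_ne_zero hA hB), Nat.factorization_lcm hA hB,
    Finsupp.sup_apply, le_sup_iff] at h
  rcases h with h | h
  · exact Or.inl ((hl.pow_dvd_iff_le_factorization hA).mpr h)
  · exact Or.inr ((hl.pow_dvd_iff_le_factorization hB).mpr h)

/-- If `𝔭₁ ≠ 𝔭₂` are primes with `N𝔭ᵢ ≢ 1 (mod lᵏ)` then no unit of `𝓞_K/𝔭₁𝔭₂ ≅ 𝓞_K/𝔭₁ × 𝓞_K/𝔭₂`
has order divisible by `lᵏ` (orders divide `lcm(N𝔭₁ - 1, N𝔭₂ - 1)`). [folklore] -/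
theorem not_dvd_orderOf_of_two_primes {v₁ v₂ : HeightOneSpectrum (𝓞 K)} (hne : v₁ ≠ v₂) {l k : ℕ}
    (hl : l.Prime) (h₁ : ((Ideal.absNorm v₁.asIdeal : ℕ) : ZMod (l ^ k)) ≠ 1)
    (h₂ : ((Ideal.absNorm v₂.asIdeal : ℕ) : ZMod (l ^ k)) ≠ 1)
    (u : (𝓞 K ⧸ v₁.asIdeal * v₂.asIdeal)ˣ) : ¬ l ^ k ∣ orderOf u := by
  haveI := v₁.isMaximal
  haveI := v₂.isMaximal
  haveI : Finite (𝓞 K ⧸ v₁.asIdeal) := Ideal.finiteQuotientOfFreeOfNeBot _ v₁.ne_bot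
  haveI : Finite (𝓞 K ⧸ v₂.asIdeal) := Ideal.finiteQuotientOfFreeOfNeBot _ v₂.ne_bot
  have hcop : IsCoprime v₁.asIdeal v₂.asIdeal := HeightOneSpectrum.isCoprime_of_ne v₁ v₂ hne
  let e : (𝓞 K ⧸ v₁.asIdeal * v₂.asIdeal)ˣ ≃* (𝓞 K ⧸ v₁.asIdeal)ˣ × (𝓞 K ⧸ v₂.asIdeal)ˣ :=
    (Units.mapEquiv (Ideal.quotientMulEquivQuotientProd _ _ hcop).toMulEquiv).trans MulEquiv.prodUnits
  intro hdvd
  rw [← e.orderOf_eq u, Prod.orderOf] at hdvd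
  rcases prime_pow_dvd_or_of_dvd_lcm hl (orderOf_pos _).ne' (orderOf_pos _).ne' hdvd with h | h
  · exact not_dvd_orderOf_of_prime v₁ h₁ _ h
  · exact not_dvd_orderOf_of_prime v₂ h₂ _ h

/-! ### Making `a` prime to `l` inside its class modulo `b` -/

omit [NumberField K] in
/-- An element lying in no prime above `w ≠ 0` is prime to `w`. [folklore] -/
theorem isCoprime_of_forall_not_mem {z w : 𝓞 K} (hw : w ≠ 0)
    (h : ∀ v : HeightOneSpectrum (𝓞 K), w ∈ v.asIdeal → z ∉ v.asIdeal) : IsCoprime z w := by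
  rw [← Ideal.isCoprime_span_singleton_iff, Ideal.isCoprime_iff_sup_eq]
  by_contra hne
  obtain ⟨M, hM, hle⟩ := Ideal.exists_le_maximal _ hne
  have hwM : w ∈ M := hle (Ideal.mem_sup_right (Ideal.mem_span_singleton_self w))
  have hzM : z ∈ M := hle (Ideal.mem_sup_left (Ideal.mem_span_singleton_self z))
  have hM0 : M ≠ ⊥ := fun h0 ↦ hw (by simpa [h0] using hwM)
  exact h ⟨M, hM.isPrime, hM0⟩ hwM hzM

/-- **Chinese remainder step**: for `a, b` coprime and `w ≠ 0` there is `t` with `a + tb` prime to `w`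
and `≠ 0` (make `a + tb ≡ 1` at the primes `𝔭 ∣ w` not containing `b`; at those containing `b`,
`a + tb ≡ a ∉ 𝔭`). [folklore] -/
theorem exists_add_mul_isCoprime {a b : 𝓞 K} (hab : IsCoprime a b) {w : 𝓞 K} (hw : w ≠ 0)
    (hwu : ¬ IsUnit w) : ∃ t : 𝓞 K, IsCoprime (a + t * b) w ∧ a + t * b ≠ 0 := by
  classical
  have hfin := Ideal.finite_factors (I := Ideal.span {w})
    (by rw [Ne, Ideal.zero_eq_bot, Ideal.span_singleton_eq_bot]; exact hw)
  set s : Finset (HeightOneSpectrum (𝓞 K)) := hfin.toFinset with hs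
  have hmem : ∀ v : HeightOneSpectrum (𝓞 K), v ∈ s ↔ w ∈ v.asIdeal := fun v ↦ by
    rw [hs, Set.Finite.mem_toFinset, Set.mem_setOf_eq, Ideal.dvd_span_singleton]
  -- targets: `1 - a` times an inverse of `b` modulo `v` when `b ∉ v`, else `0`
  have hinv : ∀ v : HeightOneSpectrum (𝓞 K), b ∉ v.asIdeal → ∃ c : 𝓞 K, c * b - 1 ∈ v.asIdeal := by
    intro v hb
    obtain ⟨c, i, hi, hci⟩ := v.isMaximal.exists_inv hb
    refine ⟨c, ?_⟩
    have : c * b - 1 = -i := by linear_combination hci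
    rw [this]
    exact v.asIdeal.neg_mem hi
  choose! inv hinv using hinv
  let x : s → 𝓞 K := fun v ↦ if b ∈ v.1.asIdeal then 0 else (1 - a) * inv v.1
  obtain ⟨t, ht⟩ := IsDedekindDomain.exists_forall_sub_mem_ideal (s := s)
    (fun v : HeightOneSpectrum (𝓞 K) ↦ v.asIdeal) (fun _ ↦ 1) (fun v _ ↦ v.prime)
    (fun v _ v' _ hvv' ↦ mt HeightOneSpectrum.ext hvv') x
  have key : ∀ v : HeightOneSpectrum (𝓞 K), w ∈ v.asIdeal → a + t * b ∉ v.asIdeal := by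
    intro v hwv
    have hv : v ∈ s := (hmem v).mpr hwv
    have htv := ht v hv
    simp only [pow_one, x] at htv
    haveI := v.isMaximal
    by_cases hbv : b ∈ v.asIdeal
    · rw [if_pos hbv, sub_zero] at htv
      intro h
      have : a ∈ v.asIdeal := by simpa using v.asIdeal.sub_mem h (v.asIdeal.mul_mem_left t hbv)
      exact Ideal.IsPrime.notMem_of_isCoprime_of_mem (I := v.asIdeal) hab.symm hbv this
    · rw [if_neg hbv] at htv
      intro h
      -- `a + t b ≡ a + (1 - a) inv b ≡ 1 (mod v)`
      have h1 : a + t * b - 1 = (t - (1 - a) * inv v) * b + (1 - a) * (inv v * b - 1) := by ring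
      have : (1 : 𝓞 K) ∈ v.asIdeal := by
        have h2 : a + t * b - 1 ∈ v.asIdeal := by
          rw [h1]
          exact v.asIdeal.add_mem (v.asIdeal.mul_mem_right _ htv)
            (v.asIdeal.mul_mem_left _ (hinv v hbv))
        simpa using v.asIdeal.sub_mem h h2
      exact v.isMaximal.ne_top ((Ideal.eq_top_iff_one _).mpr this)
  refine ⟨t, isCoprime_of_forall_not_mem hw key, fun h0 ↦ ?_⟩
  -- some prime contains `w` (it is not a unit), and it does not contain `a + tb = 0`
  obtain ⟨M, hM, hwM⟩ := exists_max_ideal_of_mem_nonunits hwu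
  have hM0 : M ≠ ⊥ := fun h ↦ hw (by simpa [h] using hwM)
  exact key ⟨M, hM.isPrime, hM0⟩ hwM (by rw [h0]; exact Ideal.zero_mem _)


/-! ### Serre's Lemme 3 for `𝔯 = (b)` over a field with a real place -/

section Main

variable {K : Type} [Field K] [NumberField K]

/-- A rational prime is not a unit of `𝓞_K` (its norm is `l^{[K:ℚ]} ≠ ±1`). [folklore] -/
theorem not_isUnit_natCast_of_prime {l : ℕ} (hl : l.Prime) : ¬ IsUnit ((l : ℕ) : 𝓞 K) := by
  intro hu
  have h1 : IsUnit (Algebra.norm ℤ ((l : ℕ) : 𝓞 K)) := hu.map _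
  have h2 : Algebra.norm ℤ ((l : ℕ) : 𝓞 K) = (l : ℤ) ^ Module.finrank ℤ (𝓞 K) := by
    rw [show ((l : ℕ) : 𝓞 K) = algebraMap ℤ (𝓞 K) (l : ℤ) by simp, Algebra.norm_algebraMap]
  rw [h2] at h1
  have hpos : 0 < Module.finrank ℤ (𝓞 K) := Module.finrank_pos
  rcases Int.isUnit_iff.mp h1 with h | h
  · have : (l : ℤ) ^ Module.finrank ℤ (𝓞 K) ≥ 2 ^ 1 := by
      calc (l : ℤ) ^ Module.finrank ℤ (𝓞 K) ≥ 2 ^ Module.finrank ℤ (𝓞 K) := by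
            gcongr; exact_mod_cast hl.two_le
        _ ≥ 2 ^ 1 := pow_le_pow_right₀ (by norm_num) hpos
    omega
  · have : (0 : ℤ) ≤ (l : ℤ) ^ Module.finrank ℤ (𝓞 K) := by positivity
    omega

/-- **Serre 1970, §2.2 Lemme 3 (for `𝔯 = (b)`, `K` with a real embedding, `m = 2`); Bass–Milnor–Serre,
Ch. I Thm. 3.2.**  Let `K` be a number field with a real embedding, `a, b ∈ 𝓞_K` coprime with
`b ≠ 0`, and `l` a prime; put `e = v_l(2)` (so `lᵉ ∥ m = #μ(K) = 2`).  Then there is `t ∈ 𝓞_K` with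
`a + tb ≠ 0` such that the unit group of `𝓞_K/(a + tb)` has **no element of order divisible by
`l^{e+1}`**.  (Serre: "Il existe alors `a ∈ A`, avec `a ≡ a₀ (mod 𝔯)`, tel que `U(a)` ne contienne
pas d'élément d'ordre multiple de `l^{e+1}`."  Proof as in BMS Thm. 3.2: `(a + tb)` is a prime or a
product of two distinct primes with norms `≢ 1 (mod l^{e+1})`, found with the ray-class Dirichlet
theorem and Chebotarev for `K(ζ_{l^{e+1}})/K`; see the module docstring.)
[cite: SerreSL2Congruence1970, §2.2 Lemme 3] -/
theorem exists_add_mul_forall_not_dvd_orderOf (σ : K →+* ℝ) {a b : 𝓞 K} (hab : IsCoprime a b)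
    (hb : b ≠ 0) {l : ℕ} (hl : l.Prime) :
    ∃ t : 𝓞 K, a + t * b ≠ 0 ∧
      ∀ u : (𝓞 K ⧸ Ideal.span {a + t * b})ˣ, ¬ l ^ (padicValNat l 2 + 1) ∣ orderOf u := by
  classical
  set k : ℕ := padicValNat l 2 + 1 with hk
  set L : ℕ := l ^ k with hL
  haveI : Fact l.Prime := ⟨hl⟩
  have hL3 : 3 ≤ L := by
    by_cases h2 : l = 2
    · subst h2
      have : padicValNat 2 2 = 1 := padicValNat.self one_lt_two
      rw [hL, hk, this]
      norm_num
    · have h0 : padicValNat l 2 = 0 :=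
        padicValNat.eq_zero_of_not_dvd fun h ↦ h2 ((Nat.prime_dvd_prime_iff_eq hl Nat.prime_two).mp h)
      rw [hL, hk, h0, zero_add, pow_one]
      have := hl.two_le
      omega
  haveI : NeZero L := ⟨by omega⟩
  have hl0 : ((l : ℕ) : 𝓞 K) ≠ 0 := by exact_mod_cast hl.ne_zero
  have hL0 : ((L : ℕ) : 𝓞 K) ≠ 0 := by exact_mod_cast (NeZero.ne L)
  -- Step 0: replace `a` by `x = a + t₀ b` prime to `l`
  obtain ⟨t₀, hxl, hx0⟩ := exists_add_mul_isCoprime hab hl0 (not_isUnit_natCast_of_prime hl)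
  set x : 𝓞 K := a + t₀ * b with hxdef
  have hxb : IsCoprime x b := hab.add_mul_right_left t₀
  have hxL : IsCoprime x ((L : ℕ) : 𝓞 K) := by
    rw [hL, Nat.cast_pow]; exact hxl.pow_right
  -- the modulus `𝔪 = (b L)`
  set 𝔪 : Ideal (𝓞 K) := Ideal.span {b * ((L : ℕ) : 𝓞 K)} with h𝔪def
  have h𝔪 : 𝔪 ≠ ⊥ := by
    rw [h𝔪def, Ne, Ideal.span_singleton_eq_bot]; exact mul_ne_zero hb hL0
  have hx𝔪 : IsCoprime (Ideal.span {x}) 𝔪 := by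
    rw [h𝔪def, Ideal.isCoprime_span_singleton_iff]; exact hxb.mul_right hxL
  have h𝔪L : 𝔪 ≤ Ideal.span {((L : ℕ) : 𝓞 K)} :=
    Ideal.span_singleton_le_span_singleton.mpr (dvd_mul_left _ _)
  have h𝔪b : 𝔪 ≤ Ideal.span {b} :=
    Ideal.span_singleton_le_span_singleton.mpr (dvd_mul_right _ _)
  -- bookkeeping common to both cases: a generator `π ≡ x (mod 𝔪)` of the signs of `x`
  have common : ∀ π : 𝓞 K, π ≠ 0 → π - x ∈ 𝔪 → (∀ φ : K →+* ℝ, 0 < φ π * φ x) →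
      (∃ t : 𝓞 K, a + t * b = π) ∧
        ((Ideal.absNorm (Ideal.span {π}) : ℕ) : ZMod L) =
          ((Ideal.absNorm (Ideal.span {x}) : ℕ) : ZMod L) := by
    intro π hπ0 hπx hpos
    refine ⟨?_, natCast_absNorm_span_singleton_eq hπ0 hx0 (h𝔪L hπx) hpos⟩
    obtain ⟨s, hs⟩ := Ideal.mem_span_singleton'.mp (h𝔪b hπx)
    exact ⟨t₀ + s, by rw [hxdef] at hs; linear_combination hs⟩
  set c : ZMod L := ((Ideal.absNorm (Ideal.span {x}) : ℕ) : ZMod L) with hcdef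
  by_cases hc : c = 1
  · -- Case `c = 1`: two primes
    let N := CyclotomicField L K
    obtain ⟨τ, hτ⟩ := exists_cycloChar_ne_one K N L hL3 σ
    have hS₁ : {v : HeightOneSpectrum (𝓞 K) | v.asIdeal ∣ 𝔪}.Finite := Ideal.finite_factors h𝔪
    obtain ⟨v₁, hv₁S, hv₁L, -, hv₁norm⟩ := exists_prime_natCast_absNorm_eq K N L τ _ hS₁
    have hv₁𝔪 : ¬ 𝔪 ≤ v₁.asIdeal := fun h ↦ hv₁S (Ideal.dvd_iff_le.mpr h)
    have hcop₁ : IsCoprime v₁.asIdeal 𝔪 := isCoprime_asIdeal_of_not_le h𝔪 hv₁𝔪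
    obtain ⟨v₂, hv₂S, -, -, π, hπ, hπx, hpos⟩ := exists_prime_mul_eq_span_singleton h𝔪
      v₁.ne_bot hcop₁ hx0 hx𝔪 {v₁} (Set.finite_singleton _)
    have hne : v₂ ≠ v₁ := fun h ↦ hv₂S (h ▸ Set.mem_singleton _)
    have hπ0 : π ≠ 0 := by
      intro h0
      rw [h0, Ideal.span_singleton_zero] at hπ
      exact mul_ne_zero v₂.ne_bot v₁.ne_bot hπ
    obtain ⟨⟨t, ht⟩, hnorm⟩ := common π hπ0 hπx hpos
    -- `N v₂ · N v₁ ≡ c = 1`, `N v₁ ≡ χ(τ) ≠ 1`, hence `N v₂ ≢ 1`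
    have hprod : ((Ideal.absNorm v₂.asIdeal : ℕ) : ZMod L) * ((Ideal.absNorm v₁.asIdeal : ℕ) : ZMod L)
        = 1 := by
      rw [← hc, ← hnorm, ← hπ, map_mul, Nat.cast_mul]
    have h₁ : ((Ideal.absNorm v₁.asIdeal : ℕ) : ZMod L) ≠ 1 := by
      rw [hv₁norm]
      intro h
      exact hτ (Units.val_eq_one.mp h)
    have h₂ : ((Ideal.absNorm v₂.asIdeal : ℕ) : ZMod L) ≠ 1 := by
      intro h
      rw [h, one_mul] at hprod
      exact h₁ hprod
    refine ⟨t, by rw [ht]; exact hπ0, ?_⟩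
    rw [ht, ← hπ]
    exact not_dvd_orderOf_of_two_primes hne hl h₂ h₁
  · -- Case `c ≠ 1`: one prime
    have htop : IsCoprime (⊤ : Ideal (𝓞 K)) 𝔪 := by
      rw [← Ideal.one_eq_top]; exact isCoprime_one_left
    obtain ⟨v, -, -, -, π, hπ, hπx, hpos⟩ := exists_prime_mul_eq_span_singleton h𝔪
      (𝔟 := ⊤) (by simp) htop hx0 hx𝔪 ∅ Set.finite_empty
    rw [Ideal.mul_top] at hπ
    have hπ0 : π ≠ 0 := by
      intro h0
      rw [h0, Ideal.span_singleton_zero] at hπ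
      exact v.ne_bot hπ
    obtain ⟨⟨t, ht⟩, hnorm⟩ := common π hπ0 hπx hpos
    have h₁ : ((Ideal.absNorm v.asIdeal : ℕ) : ZMod L) ≠ 1 := by
      rw [hπ, hnorm]; exact hc
    refine ⟨t, by rw [ht]; exact hπ0, ?_⟩
    rw [ht, ← hπ]
    exact not_dvd_orderOf_of_prime v h₁

end Main

end SerreSL2

end Literature.NumberTheory.Automorphic
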